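import Literature.Topology.FourManifolds.IntegralCurveTimeChange
import Literature.Topology.FourManifolds.RegularLevelFlowMap
import HarnessLib

/-!
# Global time change: the flow of `ρ • ξ` is the reparametrised flow of `ξ`; orbits, hitting a
# level, the projection onto a level and the stable / unstable sets are unchanged

Topic `Literature/Topology/FourManifolds`; infrastructure for the fact seat
`provefact-Literature.Topology.FourManifolds.exists_isBalancedGKTrisection` (Gay–Kirby 2016,
Thm. 4 via §4, Lemma 14), where the gradient-like field `ζ` of the Morse function (with Milnor's
normal form near the critical points, Milnor 1965, Def. 3.1) is replaced near the Heegaard level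
by the unit-speed field `ρ • ζ` (`ρ = 1/ζ(f)` on a band, Milnor's normalisation in the proof of
Thm. 3.4), and the dynamics in the Milnor boxes of `ζ` (`MilnorBoxDynamics.lean`,
`TubeFlowGeometry.lean`) has to be read for the flow of `ρ • ζ`.  Everything in this file is
**proved**; there are no definitions and no named facts.

Milnor (1965) uses tacitly, at every such normalisation (proof of Thm. 3.4, PDF pp. 12–13;
Thm. 4.4, PDF p. 24; Thm. 5.4 Assertion 4, PDF p. 29), that *the trajectories of `ρ • ξ`
(`ρ > 0`) are the trajectories of `ξ` traversed with another speed*.  The compact-interval form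
is the tree's `Literature.Topology.FourManifolds.exists_timeChange_isMIntegralCurveOn`
(`IntegralCurveTimeChange.lean`).  Here, for global flows on a compact boundaryless manifold
(`Literature.Topology.FourManifolds.flow`, `FlowsProofs.lean`):

* `exists_timeChange_isMIntegralCurve` — a global integral curve `γ` of `v` with `ρ ∘ γ`
  continuous, positive and bounded is, after the time change `e : ℝ ≃o ℝ`
  (`e = S⁻¹`, `S t = ∫₀ᵗ du/ρ(γ u)`, `e' = ρ ∘ γ ∘ e`), a global integral curve `γ ∘ e` of `ρ • v`;
* `exists_orderIso_flow_smul_eq` — **`flow (ρ • ξ) x = flow ξ x ∘ e`** for an increasing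
  self-homeomorphism `e` of `ℝ` fixing `0` (uniqueness of integral curves);
* consequences: the orbits (`range_flow_smul_eq`) and forward / backward half-orbits
  (`image_flow_smul_Ici_eq`, `image_flow_smul_Iic_eq`) coincide; a level is hit by one flow iff by
  the other (`hits_flow_smul_iff`); the limits at `±∞` coincide
  (`tendsto_flow_smul_atTop_iff`, `tendsto_flow_smul_atBot_iff`), hence **the stable and unstable
  sets of `ρ • ξ` are those of `ξ`** (`stableSet_smul_eq`, `unstableSet_smul_eq`); and for a
  gradient-like `ξ` of a Morse function the projection along trajectories onto a regular level
  is the same for both fields (`IsGradientLike.levelProj_smul_eq`).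

## References

* J. Milnor, *Lectures on the h-cobordism theorem*, notes by L. Siebenmann and J. Sondow,
  Princeton Mathematical Notes (1965), proof of Thm. 3.4 (PDF pp. 12–13), proof of Thm. 4.4
  (PDF p. 24), proof of Thm. 5.4, Assertion 4 (PDF p. 29); Def. 3.9 (PDF p. 16). [MilnorHCobordism1965]
* J. M. Lee, *Introduction to Smooth Manifolds*, 2nd ed. (2012), Thm. 9.12 (flows; uniqueness
  of integral curves). [LeeSmoothManifolds2013]
-/

open scoped Manifold ContDiff Topology
open Set Function Filter

noncomputable section

namespace Literature.Topology.FourManifolds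

open Flow

universe u

/-! ### Global time change along a global integral curve -/

section Curve

variable {E : Type*} [NormedAddCommGroup E] [NormedSpace ℝ E]
  {H : Type*} [TopologicalSpace H] {I : ModelWithCorners ℝ E H}
  {M : Type*} [TopologicalSpace M] [ChartedSpace H M]
  {v : Π x : M, TangentSpace I x} {γ : ℝ → M} {ρ : M → ℝ}

/-- **Global time change of a global integral curve** (Milnor 1965, proofs of Thms. 3.4, 4.4,
5.4: the trajectories of `ρ • v` are the reparametrised trajectories of `v`).  Let `γ` be an
integral curve of `v` on `ℝ` and `ρ` a real function on `M` which along `γ` is continuous,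
positive and bounded above.  Then there is an increasing self-homeomorphism `e` of `ℝ` (an order
isomorphism) with `e 0 = 0` and `e' s = ρ (γ (e s))`, such that `γ ∘ e` is an integral curve of
`ρ • v` on `ℝ` (`e = S⁻¹` for the new time `S t = ∫₀ᵗ du / ρ (γ u)`, a `C¹` bijection of `ℝ`
because its derivative is bounded below by a positive constant).
[cite: MilnorHCobordism1965, proof of Thm. 3.4 (PDF pp. 12–13), proof of Thm. 4.4 (PDF p. 24), proof of Thm. 5.4 Assertion 4 (PDF p. 29)] -/
theorem exists_timeChange_isMIntegralCurve (hγ : IsMIntegralCurve γ v)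
    (hρc : Continuous fun t => ρ (γ t)) (hρ : ∀ t, 0 < ρ (γ t)) {R : ℝ} (hR : ∀ t, ρ (γ t) ≤ R) :
    ∃ e : ℝ ≃o ℝ, e 0 = 0 ∧ (∀ s, HasDerivAt e (ρ (γ (e s))) s) ∧
      IsMIntegralCurve (γ ∘ e) (fun x => ρ x • v x) := by
  -- the reciprocal speed factor
  set k : ℝ → ℝ := fun t => (ρ (γ t))⁻¹ with hk
  have hR0 : 0 < R := (hρ 0).trans_le (hR 0)
  have hkpos : ∀ t, 0 < k t := fun t => inv_pos.2 (hρ t)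
  have hkc : Continuous k := hρc.inv₀ fun t => (hρ t).ne'
  have hmk : ∀ t, R⁻¹ ≤ k t := fun t => inv_anti₀ (hρ t) (hR t)
  -- the new time `S` and its inverse `e`
  set S : ℝ → ℝ := fun t => ∫ u in (0 : ℝ)..t, k u with hS
  have hSd : ∀ t, HasDerivAt S (k t) t := fun t => (hkc.integral_hasStrictDerivAt 0 t).hasDerivAt
  obtain ⟨hSmono, hSsurj⟩ := strictMono_and_surjective_of_hasDerivAt_ge (inv_pos.2 hR0) hSd hmk
  have hS0 : S 0 = 0 := intervalIntegral.integral_same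
  set e₀ : ℝ ≃o ℝ := hSmono.orderIsoOfSurjective S hSsurj with he₀
  set σ : ℝ → ℝ := ⇑e₀.symm with hσ
  have hSσ : ∀ s, S (σ s) = s := fun s => hSmono.orderIsoOfSurjective_self_symm_apply S hSsurj s
  have hσS : ∀ t, σ (S t) = t := fun t => hSmono.orderIsoOfSurjective_symm_apply_self S hSsurj t
  have hσc : Continuous σ := e₀.symm.continuous
  have hσ0 : σ 0 = 0 := by simpa only [hS0] using hσS 0
  have hσd : ∀ s, HasDerivAt σ (ρ (γ (σ s))) s := fun s => by
    have h := (hSd (σ s)).of_local_left_inverse hσc.continuousAt (hkpos _).ne'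
      (Eventually.of_forall hSσ)
    rwa [hk, inv_inv] at h
  refine ⟨e₀.symm, hσ0, hσd, ?_⟩
  -- the chain rule
  rw [isMIntegralCurve_iff_isMIntegralCurveOn]
  intro s _
  exact hasMFDerivWithinAt_comp_of_hasDerivAt ((hγ (σ s)).hasMFDerivWithinAt) (hσd s)
    (mapsTo_univ σ univ)

end Curve

/-! ### The flow of `ρ • ξ` on a compact boundaryless manifold -/

section Flow

variable {E : Type u} [NormedAddCommGroup E] [NormedSpace ℝ E] [CompleteSpace E]
  {H : Type*} [TopologicalSpace H] {I : ModelWithCorners ℝ E H}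
  {M : Type*} [TopologicalSpace M] [ChartedSpace H M] [IsManifold I ∞ M]
  [T2Space M] [CompactSpace M] [BoundarylessManifold I M]
  {ξ Y : Π x : M, TangentSpace I x} {ρ : M → ℝ}
  (hξ : ContMDiff I I.tangent ∞ fun x => (⟨x, ξ x⟩ : TangentBundle I M))
  (hY : ContMDiff I I.tangent ∞ fun x => (⟨x, Y x⟩ : TangentBundle I M))
  (hYeq : ∀ x, Y x = ρ x • ξ x) (hρc : Continuous ρ) (hρ : ∀ x, 0 < ρ x)

include hYeq hρc hρ in
/-- **The flow of `Y = ρ • ξ` is the reparametrised flow of `ξ`**: for every `x` there is an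
increasing self-homeomorphism `e` of `ℝ` with `e 0 = 0`, `e' s = ρ (flow ξ x (e s))` and
`flow Y x s = flow ξ x (e s)` for all `s` (global time change of the flow line of `x`, and
uniqueness of integral curves, Lee 2012, Thm. 9.12).
[cite: MilnorHCobordism1965, proof of Thm. 3.4 (PDF pp. 12–13), proof of Thm. 5.4 Assertion 4 (PDF p. 29)] [cite: LeeSmoothManifolds2013, Thm. 9.12] -/
theorem exists_orderIso_flow_smul_eq (x : M) :
    ∃ e : ℝ ≃o ℝ, e 0 = 0 ∧ (∀ s, HasDerivAt e (ρ (flow hξ x (e s))) s) ∧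
      ∀ s, flow hY x s = flow hξ x (e s) := by
  -- `ρ` is bounded on the compact manifold
  obtain ⟨x₀, -, hx₀⟩ := isCompact_univ.exists_isMaxOn ⟨x, mem_univ x⟩ hρc.continuousOn
  have hR : ∀ t, ρ (flow hξ x t) ≤ ρ x₀ := fun t => hx₀ (mem_univ _)
  obtain ⟨e, he0, hed, hcurve⟩ := exists_timeChange_isMIntegralCurve (isMIntegralCurve_flow hξ x)
    (hρc.comp (continuous_flow hξ x)) (fun t => hρ _) hR
  have hfun : (fun x => ρ x • ξ x) = Y := funext fun x => (hYeq x).symm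
  rw [hfun] at hcurve
  refine ⟨e, he0, hed, fun s => ?_⟩
  have h := congrFun (eq_flow_of_isMIntegralCurve hY hcurve) s
  simp only [comp_apply, he0, flow_zero] at h
  exact h.symm

include hYeq hρc hρ in
/-- **The orbits of `ρ • ξ` and of `ξ` coincide as point sets.** [cite: MilnorHCobordism1965, proof of Thm. 3.4 (PDF pp. 12–13)] -/
theorem range_flow_smul_eq (x : M) : range (flow hY x) = range (flow hξ x) := by
  obtain ⟨e, -, -, he⟩ := exists_orderIso_flow_smul_eq hξ hY hYeq hρc hρ x
  ext y
  constructor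
  · rintro ⟨s, rfl⟩; exact ⟨e s, (he s).symm⟩
  · rintro ⟨t, rfl⟩; exact ⟨e.symm t, by rw [he, OrderIso.apply_symm_apply]⟩

include hYeq hρc hρ in
/-- **The forward half-orbits coincide**: `flow (ρ • ξ) x [0, ∞) = flow ξ x [0, ∞)`. [cite: MilnorHCobordism1965, Def. 3.9 (PDF p. 16)] -/
theorem image_flow_smul_Ici_eq (x : M) : flow hY x '' Ici 0 = flow hξ x '' Ici 0 := by
  obtain ⟨e, he0, -, he⟩ := exists_orderIso_flow_smul_eq hξ hY hYeq hρc hρ x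
  ext y
  constructor
  · rintro ⟨s, hs, rfl⟩
    refine ⟨e s, ?_, (he s).symm⟩
    have : e 0 ≤ e s := e.monotone hs
    rwa [he0] at this
  · rintro ⟨t, ht, rfl⟩
    refine ⟨e.symm t, ?_, by rw [he, OrderIso.apply_symm_apply]⟩
    have : e.symm (e 0) ≤ e.symm t := e.symm.monotone (by rw [he0]; exact ht)
    rwa [OrderIso.symm_apply_apply] at this

include hYeq hρc hρ in
/-- **The backward half-orbits coincide**: `flow (ρ • ξ) x (-∞, 0] = flow ξ x (-∞, 0]`. [cite: MilnorHCobordism1965, Def. 3.9 (PDF p. 16)] -/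
theorem image_flow_smul_Iic_eq (x : M) : flow hY x '' Iic 0 = flow hξ x '' Iic 0 := by
  obtain ⟨e, he0, -, he⟩ := exists_orderIso_flow_smul_eq hξ hY hYeq hρc hρ x
  ext y
  constructor
  · rintro ⟨s, hs, rfl⟩
    refine ⟨e s, ?_, (he s).symm⟩
    have : e s ≤ e 0 := e.monotone hs
    rwa [he0] at this
  · rintro ⟨t, ht, rfl⟩
    refine ⟨e.symm t, ?_, by rw [he, OrderIso.apply_symm_apply]⟩
    have : e.symm t ≤ e.symm (e 0) := e.symm.monotone (by rw [he0]; exact ht)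
    rwa [OrderIso.symm_apply_apply] at this

include hYeq hρc hρ in
/-- **The limits at `+∞` coincide**: `flow (ρ • ξ) x → p` as `t → +∞` iff `flow ξ x → p`. [cite: MilnorHCobordism1965, Def. 3.9 (PDF p. 16)] -/
theorem tendsto_flow_smul_atTop_iff (x p : M) :
    Tendsto (flow hY x) atTop (𝓝 p) ↔ Tendsto (flow hξ x) atTop (𝓝 p) := by
  obtain ⟨e, -, -, he⟩ := exists_orderIso_flow_smul_eq hξ hY hYeq hρc hρ x
  have hfun : flow hY x = flow hξ x ∘ e := funext he
  constructor
  · intro h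
    have h' : Tendsto ((flow hξ x ∘ e) ∘ e.symm) atTop (𝓝 p) := (hfun ▸ h).comp e.symm.tendsto_atTop
    refine h'.congr fun t => ?_
    simp only [comp_apply, OrderIso.apply_symm_apply]
  · intro h
    rw [hfun]
    exact h.comp e.tendsto_atTop

include hYeq hρc hρ in
/-- **The limits at `-∞` coincide**: `flow (ρ • ξ) x → p` as `t → -∞` iff `flow ξ x → p`. [cite: MilnorHCobordism1965, Def. 3.9 (PDF p. 16)] -/
theorem tendsto_flow_smul_atBot_iff (x p : M) :
    Tendsto (flow hY x) atBot (𝓝 p) ↔ Tendsto (flow hξ x) atBot (𝓝 p) := by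
  obtain ⟨e, -, -, he⟩ := exists_orderIso_flow_smul_eq hξ hY hYeq hρc hρ x
  have hfun : flow hY x = flow hξ x ∘ e := funext he
  constructor
  · intro h
    have h' : Tendsto ((flow hξ x ∘ e) ∘ e.symm) atBot (𝓝 p) := (hfun ▸ h).comp e.symm.tendsto_atBot
    refine h'.congr fun t => ?_
    simp only [comp_apply, OrderIso.apply_symm_apply]
  · intro h
    rw [hfun]
    exact h.comp e.tendsto_atBot

include hξ hY hYeq hρc hρ in
/-- **The stable sets of `ρ • ξ` are those of `ξ`** (Milnor's Def. 3.9: the points on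
trajectories going to `p`). [cite: MilnorHCobordism1965, Def. 3.9 (PDF p. 16)] -/
theorem stableSet_smul_eq (p : M) : stableSet I Y p = stableSet I ξ p := by
  rw [stableSet_eq_setOf_tendsto hY, stableSet_eq_setOf_tendsto hξ]
  ext x
  exact tendsto_flow_smul_atTop_iff hξ hY hYeq hρc hρ x p

include hξ hY hYeq hρc hρ in
/-- **The unstable sets of `ρ • ξ` are those of `ξ`** (the points on trajectories coming from
`p`). [cite: MilnorHCobordism1965, Def. 3.9 (PDF p. 16)] -/
theorem unstableSet_smul_eq (p : M) : unstableSet I Y p = unstableSet I ξ p := by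
  rw [unstableSet_eq_setOf_tendsto hY, unstableSet_eq_setOf_tendsto hξ]
  ext x
  exact tendsto_flow_smul_atBot_iff hξ hY hYeq hρc hρ x p

include hYeq hρc hρ in
/-- **A level is hit by the flow of `ρ • ξ` iff it is hit by the flow of `ξ`** (same orbits). [cite: MilnorHCobordism1965, proof of Thm. 5.4 Assertion 4 (PDF p. 29)] -/
theorem hits_flow_smul_iff {f : M → ℝ} {a : ℝ} (x : M) :
    Hits (fun q : ℝ × M => flow hY q.2 q.1) f a x ↔ Hits (fun q : ℝ × M => flow hξ q.2 q.1) f a x := by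
  obtain ⟨e, -, -, he⟩ := exists_orderIso_flow_smul_eq hξ hY hYeq hρc hρ x
  constructor
  · rintro ⟨s, hs⟩
    exact ⟨e s, by show f (flow hξ x (e s)) = a; rw [← he]; exact hs⟩
  · rintro ⟨t, ht⟩
    exact ⟨e.symm t, by show f (flow hY x (e.symm t)) = a; rw [he, OrderIso.apply_symm_apply]; exact ht⟩

include hYeq hρc hρ in
/-- **The point of a level on an orbit, when unique, is the same for both flows**: if the orbit of
`x` under `ξ` meets the level `f = a` in at most one point, then the projections along
trajectories of `ρ • ξ` and of `ξ` (`levelProj`: the flow at the hitting time) agree at `x`. [cite: MilnorHCobordism1965, Thm. 4.1 (PDF p. 22); proof of Thm. 5.4 Assertion 4 (PDF p. 29)] -/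
theorem levelProj_smul_eq_of_unique {f : M → ℝ} {a : ℝ} {x : M}
    (huniq : ∀ t t' : ℝ, f (flow hξ x t) = a → f (flow hξ x t') = a → flow hξ x t = flow hξ x t')
    (hx : Hits (fun q : ℝ × M => flow hξ q.2 q.1) f a x) :
    flow hY x (hittingTime (fun q : ℝ × M => flow hY q.2 q.1) f a x) =
      flow hξ x (hittingTime (fun q : ℝ × M => flow hξ q.2 q.1) f a x) := by
  obtain ⟨e, -, -, he⟩ := exists_orderIso_flow_smul_eq hξ hY hYeq hρc hρ x
  have hxY : Hits (fun q : ℝ × M => flow hY q.2 q.1) f a x := by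
    obtain ⟨t, ht⟩ := hx
    exact ⟨e.symm t, by show f (flow hY x (e.symm t)) = a; rw [he, OrderIso.apply_symm_apply]; exact ht⟩
  have h1 : f (flow hY x (hittingTime (fun q : ℝ × M => flow hY q.2 q.1) f a x)) = a :=
    apply_hittingTime hxY
  have h2 : f (flow hξ x (hittingTime (fun q : ℝ × M => flow hξ q.2 q.1) f a x)) = a :=
    apply_hittingTime hx
  rw [he] at h1 ⊢
  exact huniq _ _ h1 h2

end Flow

/-! ### Gradient-like fields: the projection onto a regular level -/

section GradientLike

variable {m : ℕ} {H : Type*} [TopologicalSpace H] {J : ModelWithCorners ℝ (EuclideanSpace ℝ (Fin m)) H}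
  {M : Type*} [TopologicalSpace M] [ChartedSpace H M] [IsManifold J ∞ M]
  [T2Space M] [CompactSpace M] [BoundarylessManifold J M]
  {f : M → ℝ} {ξ Y : Π x : M, TangentSpace J x} {ρ : M → ℝ}
  (hξ : ContMDiff J J.tangent ∞ fun x => (⟨x, ξ x⟩ : TangentBundle J M))
  (hY : ContMDiff J J.tangent ∞ fun x => (⟨x, Y x⟩ : TangentBundle J M))
  (hYeq : ∀ x, Y x = ρ x • ξ x) (hρc : Continuous ρ) (hρ : ∀ x, 0 < ρ x)

include hYeq hρc hρ in
/-- `Hits` for the global flows of `ρ • ξ` and `ξ` agree. [cite: MilnorHCobordism1965, proof of Thm. 5.4 Assertion 4 (PDF p. 29)] -/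
theorem hits_flowθ_smul_iff {a : ℝ} (x : M) : Hits (flowθ hY) f a x ↔ Hits (flowθ hξ) f a x :=
  hits_flow_smul_iff hξ hY hYeq hρc hρ x

include hYeq hρc hρ in
/-- **For a gradient-like field of a Morse function, the projection along trajectories onto a
level is unchanged by the time change**: `levelProj (ρ • ξ) f a x = levelProj ξ f a x` at every
point `x` whose orbit meets the level and which is not critical (along a non-constant orbit `f`
is strictly increasing, so the level is met once). [cite: MilnorHCobordism1965, Thm. 4.1 (PDF p. 22); proof of Thm. 3.4 (PDF pp. 12–13)] -/
theorem IsGradientLike.levelProj_smul_eq (hgl : IsGradientLike J f ξ) (hfM : IsMorse J f) {a : ℝ}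
    {x : M} (hx : Hits (flowθ hξ) f a x) (hxc : ¬ IsMCriticalPt J f x) :
    levelProj hY f a x = levelProj hξ f a x := by
  unfold levelProj
  refine levelProj_smul_eq_of_unique hξ hY hYeq hρc hρ (fun t t' ht ht' => ?_) hx
  have hinj := (hgl.strictMono_comp_flow hfM hξ hxc).injective
  have : t = t' := hinj (ht.trans ht'.symm)
  rw [this]

include hYeq hρc hρ in
/-- The same at a point of a level without critical points (e.g. for the points of the band
around a regular level, which all hit it). [cite: MilnorHCobordism1965, Thm. 4.1 (PDF p. 22)] -/
theorem IsGradientLike.levelProj_smul_eq_of_level (hgl : IsGradientLike J f ξ) (hfM : IsMorse J f)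
    {a : ℝ} (ha : ∀ y, f y = a → ¬ IsMCriticalPt J f y) {x : M} (hx : Hits (flowθ hξ) f a x) :
    levelProj hY f a x = levelProj hξ f a x := by
  refine hgl.levelProj_smul_eq hξ hY hYeq hρc hρ hfM hx fun hxc => ?_
  -- a critical point is fixed by the flow, so its orbit meets the level only if it is on it
  obtain ⟨t, ht⟩ := hx
  have hfix : flow hξ x t = x :=
    flow_eq_self_of_apply_eq_zero hξ (hgl.apply_eq_zero_of_isMCriticalPt hxc) t
  have ht' : f (flow hξ x t) = a := ht
  rw [hfix] at ht'
  exact ha x ht' hxc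

end GradientLike

end Literature.Topology.FourManifolds

end
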